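import Summits.AtomisticToContinuum.Crystallization.Theorems.FrustratedLawDichotomyStrainedPatchHomEntrySix

/-!
# NINE-COORDINATE hcp search (6 symmetrised entries + 3 shuffle coordinates): the lower-triangle entries of the hcp entry + shuffle cube are never bisected

decomp-a2c hand-1 g21 (crux `AperiodicFrustratedLawGap`, stmt-AtomisticToContinuum-27623; hcp twin of `…HomEntrySix`, critic row 828 (B)(4) «E-SYM»).  hand-2's hcp
verdict `entryLeafOKH2 μ` works on the 12-coordinate cube `(Fin 3 × Fin 3) ⊕ Fin 3` (entries of a SELF-ADJOINT `U`, shuffle `ξ`); as on the fcc side, the three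
lower-triangle entry coordinates are redundant.  `symIdxH` mirrors them onto the upper triangle (shuffle coordinates untouched), ★ `entryLeafOKH6 μ :=
entryLeafOKH2 μ ∘ symH` is sound in the hcp `hver` shape (`entryLeafOKH6_sound`, via `…HomEntrySix.hbox_sym`), the selector `rr9H` bisects only the six upper
entries and the three shuffle coordinates, ★★ `hcpHalf_of_entrySearchH6`, and ★★★ `homFloor_of_entrySearches66` : `(H) HomFloor m` from the six-coordinate fcc
search (fundamental domain) and the nine-coordinate hcp search; corollaries at `m = 1/625` (`muRec`) and `m = 1/1000` (`muMilli`).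

0 sorry; standard axioms; no instances / notation / `#eval`.  `--supports stmt-AtomisticToContinuum-27623`.
-/

namespace Summit.AtomisticToContinuum.Crystallization.Theorems.FrustratedLawDichotomyStrainedPatchHomEntrySixHcp

open scoped BigOperators RealInnerProductSpace
open Literature.Analysis.ValidatedNumerics.Numerics
open Summit.AtomisticToContinuum.Crystallization.Theorems.ChargedEnergyGapNegative (E3)
open Summit.AtomisticToContinuum.Crystallization.Theorems.FrustratedLawDichotomySchurCut (effPot w₄₅ ω₄)
open Summit.AtomisticToContinuum.Crystallization.Theorems.FrustratedLawDichotomyAveragingRuleTightFree (TightNearCap BadNearCap)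
open Summit.AtomisticToContinuum.Crystallization.Theorems.FrustratedLawDichotomyExemptAbsorption (ExemptNear)
open Summit.AtomisticToContinuum.Crystallization.Theorems.FrustratedLawDichotomyStrainedPatchHomSplit
open Summit.AtomisticToContinuum.Crystallization.Theorems.FrustratedLawDichotomyStrainedPatchHomPrunedPolar (homFloor_of_prunedBoxSums_selfAdjoint)
open Summit.AtomisticToContinuum.Crystallization.Theorems.FrustratedLawDichotomyStrainedPatchHomCertTree (CertTree treeOK)
open Summit.AtomisticToContinuum.Crystallization.Theorems.FrustratedLawDichotomyStrainedPatchHomEntryGram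
open Summit.AtomisticToContinuum.Crystallization.Theorems.FrustratedLawDichotomyStrainedPatchHomEntryGramHcp (rootCH rootWH)
open Summit.AtomisticToContinuum.Crystallization.Theorems.FrustratedLawDichotomyStrainedPatchHomEntryFitHcp (entryLeafOKH2 entryLeafOKH2_sound)
open Summit.AtomisticToContinuum.Crystallization.Theorems.FrustratedLawDichotomyStrainedPatchHomEntryTable (muRec muRec_ok)
open Summit.AtomisticToContinuum.Crystallization.Theorems.FrustratedLawDichotomyStrainedPatchHomEntrySearch
open Summit.AtomisticToContinuum.Crystallization.Theorems.FrustratedLawDichotomyStrainedPatchHomEntrySix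
open Literature.Barriers.AtomisticToContinuum.FlatleyTheil2015 (fccVec)

/-! ## §1. Symmetrisation of the entry block of an hcp box -/

/-- Mirror the lower-triangle ENTRY coordinates; shuffle coordinates untouched. -/
def symIdxH : (Fin 3 × Fin 3) ⊕ Fin 3 → (Fin 3 × Fin 3) ⊕ Fin 3 := Sum.map symIdx id

/-- [formal bookkeeping] -/
theorem symIdxH_inl (ab : Fin 3 × Fin 3) : symIdxH (Sum.inl ab) = Sum.inl (symIdx ab) := rfl

/-- [formal bookkeeping] -/
theorem symIdxH_inr (i : Fin 3) : symIdxH (Sum.inr i) = Sum.inr i := rfl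

/-- ★ **THE NINE-COORDINATE hcp VERDICT**: hand-2's `entryLeafOKH2 μ` ((P1) fit ∨ symmetry ∨ column ∨ (P4)) on the symmetrised box. -/
def entryLeafOKH6 (μ : ℤ) (c w : (Fin 3 × Fin 3) ⊕ Fin 3 → ℤ) : Bool := entryLeafOKH2 μ (c ∘ symIdxH) (w ∘ symIdxH)

/-- ★ Soundness of `entryLeafOKH6` in the hcp `hver` shape of `…HomEntryGramHcp.hcpHalf_of_entryTree` (self-adjointness ⟹ the entries lie in the
symmetrised box, `…HomEntrySix.hbox_sym`). [folklore] -/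
theorem entryLeafOKH6_sound {μ : ℤ} {c w : (Fin 3 × Fin 3) ⊕ Fin 3 → ℤ} (h : entryLeafOKH6 μ c w = true) (U : E3 →L[ℝ] E3) (ξ : E3)
    (hsa : ∀ v v' : E3, ⟪U v, v'⟫ = ⟪v, U v'⟫) (hU : ‖U - 1‖ ≤ 1 / 4)
    (hbox : ∀ ab : Fin 3 × Fin 3, |(U (EuclideanSpace.single ab.2 (1 : ℝ))) ab.1 - (c (Sum.inl ab) : ℝ) / SC| ≤ (w (Sum.inl ab) : ℝ) / SC)
    (hξb : ∀ i : Fin 3, |ξ i - (c (Sum.inr i) : ℝ) / SC| ≤ (w (Sum.inr i) : ℝ) / SC) :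
    (∀ (M : ℕ) (z : Fin M → E3) (c : Fin M), Function.Injective z →
        Set.range z = {x : E3 | dist x (z c) ≤ 133 / 10 ∧ ∃ a : Fin 3 → ℤ,
          x = z c + latPt U hexFrame a ∨ x = z c + latPt U hexFrame a + U (hcpShift + ξ)} →
        TightNearCap (9 / 5) (3 / 2) z c ∨ ExemptNear (9 / 5) ExRec z c ∨ BadNearCap (9 / 5) (3 / 2) z c) ∨
      (μ : ℝ) / SC ≤ ∑ b ∈ (Fintype.piFinset fun _ : Fin 3 => Finset.Icc (-7 : ℤ) 7).filter (fun b => b ≠ 0), effPot w₄₅ ω₄ (3 / 400) ‖latPt U hexFrame b‖ +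
        ∑ b ∈ (Fintype.piFinset fun _ : Fin 3 => Finset.Icc (-7 : ℤ) 7), effPot w₄₅ ω₄ (3 / 400) ‖latPt U hexFrame b + U (hcpShift + ξ)‖ :=
  entryLeafOKH2_sound h U ξ hsa hU
    (fun ab => by
      have := hbox_sym hsa (c := fun ab => c (Sum.inl ab)) (w := fun ab => w (Sum.inl ab)) hbox ab
      simpa only [Function.comp_apply, symIdxH_inl] using this)
    (fun i => by simpa only [Function.comp_apply, symIdxH_inr] using hξb i)

/-- The nine bisected hcp coordinates: diagonal entries, upper off-diagonal entries, shuffle. -/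
def order9H : List ((Fin 3 × Fin 3) ⊕ Fin 3) :=
  [Sum.inl (0, 0), Sum.inl (1, 1), Sum.inl (2, 2), Sum.inl (0, 1), Sum.inl (0, 2), Sum.inl (1, 2), Sum.inr 0, Sum.inr 1, Sum.inr 2]

/-- ★ Selector for the nine-coordinate hcp search (lower-triangle entries never bisected). -/
def rr9H : ℕ → ((Fin 3 × Fin 3) ⊕ Fin 3 → ℤ) → ((Fin 3 × Fin 3) ⊕ Fin 3 → ℤ) → (Fin 3 × Fin 3) ⊕ Fin 3 :=
  fun _ _ w => pick (Sum.inl (0, 0)) order9H w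

/-! ## §2. The `(H)` theorems -/

/-- ★★ **THE hcp HALF FROM ONE NINE-COORDINATE SEARCH** (any selector / fuel / start depth). [folklore] -/
theorem hcpHalf_of_entrySearchH6 {m : ℝ} {μ : ℤ} (hμ : 2 * (m + (-(7175 / 10000) + 3 / 400)) * SC ≤ μ)
    {sel : ℕ → ((Fin 3 × Fin 3) ⊕ Fin 3 → ℤ) → ((Fin 3 × Fin 3) ⊕ Fin 3 → ℤ) → (Fin 3 × Fin 3) ⊕ Fin 3} {fuel d : ℕ}
    (h : searchOK (entryLeafOKH6 μ) sel fuel d rootCH rootWH = true) :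
    ∀ (U : E3 →L[ℝ] E3) (ξ : E3), (∀ v w : E3, inner ℝ (U v) w = inner ℝ v (U w)) → (∀ w : E3, 0 ≤ inner ℝ w (U w)) →
      ‖U - 1‖ ≤ 1 / 4 → ‖ξ‖ ≤ 1 / 4 →
      (∀ (M : ℕ) (z : Fin M → E3) (c : Fin M), Function.Injective z →
          Set.range z = {x : E3 | dist x (z c) ≤ 133 / 10 ∧ ∃ a : Fin 3 → ℤ,
            x = z c + latPt U hexFrame a ∨ x = z c + latPt U hexFrame a + U (hcpShift + ξ)} →
          TightNearCap (9 / 5) (3 / 2) z c ∨ ExemptNear (9 / 5) ExRec z c ∨ BadNearCap (9 / 5) (3 / 2) z c) ∨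
      m ≤ (∑ b ∈ (Fintype.piFinset fun _ : Fin 3 => Finset.Icc (-7 : ℤ) 7).filter (fun b => b ≠ 0),
          effPot w₄₅ ω₄ (3 / 400) ‖latPt U hexFrame b‖ +
        ∑ b ∈ (Fintype.piFinset fun _ : Fin 3 => Finset.Icc (-7 : ℤ) 7),
          effPot w₄₅ ω₄ (3 / 400) ‖latPt U hexFrame b + U (hcpShift + ξ)‖) / 2 - (-(7175 / 10000) + 3 / 400) :=
  hcpHalf_of_entrySearch hμ (entryLeafOKH6 μ) (fun _ _ hv U ξ hsa hU hbox hξ => entryLeafOKH6_sound hv U ξ hsa hU hbox hξ) h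

/-- ★★★ **`(H) HomFloor m` FROM TWO REDUCED SEARCHES**: six-coordinate fcc search over the fundamental domain (`entryLeafOK6`), nine-coordinate hcp search
(`entryLeafOKH6`). [folklore] -/
theorem homFloor_of_entrySearches66 {m : ℝ} {μ : ℤ} (hμ : 2 * (m + (-(7175 / 10000) + 3 / 400)) * SC ≤ μ)
    {selF : ℕ → (Fin 3 × Fin 3 → ℤ) → (Fin 3 × Fin 3 → ℤ) → Fin 3 × Fin 3} {fuelF dF : ℕ}
    (hF : searchOK (entryLeafOK6 μ) selF fuelF dF rootC rootW = true)
    {selH : ℕ → ((Fin 3 × Fin 3) ⊕ Fin 3 → ℤ) → ((Fin 3 × Fin 3) ⊕ Fin 3 → ℤ) → (Fin 3 × Fin 3) ⊕ Fin 3} {fuelH dH : ℕ}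
    (hH : searchOK (entryLeafOKH6 μ) selH fuelH dH rootCH rootWH = true) : HomFloor m :=
  homFloor_of_prunedBoxSums_selfAdjoint (fccHalf_of_entrySearch6 hμ hF) (hcpHalf_of_entrySearchH6 hμ hH)

/-- ★★★ `HomFloor (1/625)` from the two reduced searches at `μ⋆ = muRec`. [folklore] -/
theorem homFloor_625_of_entrySearches66
    {selF : ℕ → (Fin 3 × Fin 3 → ℤ) → (Fin 3 × Fin 3 → ℤ) → Fin 3 × Fin 3} {fuelF dF : ℕ}
    (hF : searchOK (entryLeafOK6 muRec) selF fuelF dF rootC rootW = true)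
    {selH : ℕ → ((Fin 3 × Fin 3) ⊕ Fin 3 → ℤ) → ((Fin 3 × Fin 3) ⊕ Fin 3 → ℤ) → (Fin 3 × Fin 3) ⊕ Fin 3} {fuelH dH : ℕ}
    (hH : searchOK (entryLeafOKH6 muRec) selH fuelH dH rootCH rootWH = true) : HomFloor (1 / 625) :=
  homFloor_of_entrySearches66 muRec_ok hF hH

/-- ★★★ `HomFloor (1/1000)` from the two reduced searches at `μ_milli`. [folklore] -/
theorem homFloor_milli_of_entrySearches66
    {selF : ℕ → (Fin 3 × Fin 3 → ℤ) → (Fin 3 × Fin 3 → ℤ) → Fin 3 × Fin 3} {fuelF dF : ℕ}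
    (hF : searchOK (entryLeafOK6 muMilli) selF fuelF dF rootC rootW = true)
    {selH : ℕ → ((Fin 3 × Fin 3) ⊕ Fin 3 → ℤ) → ((Fin 3 × Fin 3) ⊕ Fin 3 → ℤ) → (Fin 3 × Fin 3) ⊕ Fin 3} {fuelH dH : ℕ}
    (hH : searchOK (entryLeafOKH6 muMilli) selH fuelH dH rootCH rootWH = true) : HomFloor (1 / 1000) :=
  homFloor_of_entrySearches66 muMilli_ok hF hH

/-! ## §3. Kernel smoke tests -/

/-- `rr9H` starts on the first diagonal entry and reaches the shuffle block once the entries are narrower; the verdict ignores the lower triangle: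
a box whose LOWER entry `(1,0)` alone is far off is still accepted at depth 0 at `(U, ξ) = (1, 0)` (fit prune). -/
example : rr9H 0 rootCH rootWH = Sum.inl (0, 0) ∧
    rr9H 0 rootCH (fun k => match k with | Sum.inl _ => 5 | Sum.inr _ => 70368744177664) = Sum.inr 0 ∧
    entryLeafOKH6 muRec (Function.update rootCH (Sum.inl (1, 0)) 99999999999999) (fun _ => 549755813888) = true := by
  decide +kernel

end Summit.AtomisticToContinuum.Crystallization.Theorems.FrustratedLawDichotomyStrainedPatchHomEntrySixHcp
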